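import Summits.AtomisticToContinuum.BoseEinsteinCondensation.Theorems.BECCutLineWeakDisorderTaggedShiftDefs
import Summits.AtomisticToContinuum.BoseEinsteinCondensation.Theorems.BECCutLineWeakDisorderTwoReplicaTransienceBoundFreeGas
import Literature.Analysis.FluidPDE.PoincareBall
import HarnessLib

/-!
# Route `BECCutLineWeakDisorder`, crux `TwoReplicaTransienceBound` (stmt-AtomisticToContinuum-9687),
# line `tagged-shift-log-harnack`: the coarse (across-block) participation — block Cauchy–Schwarz
# and the FREE-GAS instance of the IR stub `stub_coarseSecondMomentBeyond`

Support file (`--supports stmt-AtomisticToContinuum-9687`; proves the registered TOOLBOX stub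
`stub_coarseSecondMomentFreeGas` (lead a1), NOT the registered stub
`stub_coarseSecondMomentBeyond : Goal.stub_coarseSecondMomentBeyond` of
`Theorems/BECCutLineWeakDisorderTaggedShiftDefs.lean`, which is the crux's infrared heart at block
resolution — block-level ODLRO of the cut-line witness, BEC-strength, open).

* `pow_mul_levelSq_le` — block Cauchy–Schwarz `8^K S_K(g) ≤ L³ ∫ g²` (`a_Q² ≤ |Q| ∫_Q g²`,
  `|Q| = (L2^{-K})³`, disjoint blocks), i.e. `r̄_K ≥ 1` off junk;
* `levelSq_zero_eq` — `S_0(g) = (∫ g)²` for `g` vanishing off `Λ_L`;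
* `ofReal_coarse_le_ratio` — **the across-block participation is dominated by the full one**:
  `∏_{j<K} (1 + X_j(g)) = 8^K S_K/S_0 ≤ L³ ∫g² / (∫g)²` for every depth `K` (so the IR stub is
  implied by the slice-law SECOND moment of the crux's functional `R_T = L³ m_T/s_T²`);
* `stub_coarseSecondMomentFreeGas` — for the FREE gas `v ≡ 0` the slice of the witness is
  `Y`-independent up to a scalar (`fkPartition_vecCons_free`), the sibling excesses are scale-free
  (`siblingExcess_const_mul`), so the integrand's second factor is the deterministic number
  `(∏_{j<K}(1 + X_j(θ_T)))² ≤ (L³∫θ_T²/(∫θ_T)²)² ≤ C²` (`free_ratio_le`) and the slice law has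
  mass `≤ 1` (`lintegral_lintegral_slice_sq`): ONE constant for every `L > 0`, `n`, `T ≥ 0` and
  EVERY depth `K`;
* `coarseSecondMomentBeyond_free` — the `v := fun _ => 0` instance of `CoarseSecondMomentBeyond`
  with all its other quantifiers verbatim (they are idle for the free gas).
-/

noncomputable section

open MeasureTheory Filter Set Finset
open scoped ENNReal NNReal Topology BigOperators

namespace Summit.AtomisticToContinuum.BoseEinsteinCondensation.Cruxes.TwoReplicaTransienceBound.TaggedShiftLogHarnack

open Literature.MathematicalPhysics.QuantumManyBody.BoseGas
open Summit.AtomisticToContinuum.BoseEinsteinCondensation.Theses.BECCutLineWeakDisorder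
open Summit.AtomisticToContinuum.BoseEinsteinCondensation.Cruxes.LandscapeBound.SiblingTelescopingChaining
open Summit.AtomisticToContinuum.BoseEinsteinCondensation.Cruxes.TwoReplicaTransienceBound.TracerDecoupling
  (fkWitness_one_eq fkPartition_ne_top)
open Summit.AtomisticToContinuum.BoseEinsteinCondensation.Cruxes.TwoReplicaTransienceBound.FreeGas
  (fkPartition_vecCons_free free_ratio_le measurable_fkPartition_one)
open Summit.AtomisticToContinuum.BoseEinsteinCondensation.Theorems.CutLineWitness (volume_box_ne_top)

variable {n : ℕ}

/-! ### Block Cauchy–Schwarz: the coarse participation is at most the full participation -/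

-- adapted from Cruxes/LandscapeBound/Lines/sibling_telescoping_chaining.lean (`volume_dyadicCube`)
/-- Volume of a dyadic block: `|Q| = ℓ³`, `ℓ = L2^{-j}` (`L ≥ 0`). [folklore] -/
theorem volume_dyadicCube {L : ℝ} (hL : 0 ≤ L) (j : ℕ) (i : Fin 3 → Fin (2 ^ j)) :
    volume (dyadicCube L j i) = ENNReal.ofReal ((L / 2 ^ j) ^ 3) := by
  have h : dyadicCube L j i = (@WithLp.ofLp 2 (Fin 3 → ℝ)) ⁻¹'
      (Set.univ.pi fun d => Set.Ico (L * (i d : ℕ) / 2 ^ j) (L * ((i d : ℕ) + 1) / 2 ^ j)) := by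
    ext x; simp [dyadicCube]
  rw [h, (PiLp.volume_preserving_ofLp (Fin 3)).measure_preimage
    (MeasurableSet.univ_pi fun _ => measurableSet_Ico).nullMeasurableSet, volume_pi_pi]
  simp only [Real.volume_Ico]
  have h2 : ∀ d : Fin 3, L * ((i d : ℕ) + 1) / 2 ^ j - L * (i d : ℕ) / 2 ^ j = L / 2 ^ j :=
    fun d => by ring
  simp_rw [h2]
  rw [Finset.prod_const, Finset.card_univ, Fintype.card_fin, ENNReal.ofReal_pow (by positivity)]

/-- Block Cauchy–Schwarz: `a_Q² ≤ |Q| ∫_Q g²`. [folklore] -/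
theorem blockMass_sq_le {g : Space → ℝ≥0∞} (hg : Measurable g) {L : ℝ} (hL : 0 ≤ L) (j : ℕ)
    (i : Fin 3 → Fin (2 ^ j)) :
    blockMass g L j i ^ 2 ≤ ENNReal.ofReal ((L / 2 ^ j) ^ 3) * ∫⁻ x in dyadicCube L j i, g x ^ 2 := by
  unfold blockMass
  refine (Literature.Analysis.FluidPDE.PoincareBall.sq_lintegral_le_measure_mul_lintegral_sq _
    hg.aemeasurable).trans_eq ?_
  rw [Measure.restrict_apply_univ, volume_dyadicCube hL]

/-- The blocks of one level are disjoint: `Σ_Q ∫_Q f ≤ ∫ f`. [folklore] -/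
theorem sum_setLIntegral_dyadicCube_le (L : ℝ) (j : ℕ) (f : Space → ℝ≥0∞) :
    ∑ i : Fin 3 → Fin (2 ^ j), ∫⁻ x in dyadicCube L j i, f x ≤ ∫⁻ x, f x := by
  have h : ∫⁻ x in ⋃ i, dyadicCube L j i, f x = ∑ i, ∫⁻ x in dyadicCube L j i, f x := by
    rw [lintegral_iUnion (fun i => measurableSet_dyadicCube L j i)
      (fun _ _ h => disjoint_dyadicCube L j h), tsum_fintype]
  rw [← h]
  exact setLIntegral_le_lintegral _ _

/-- **`8^K S_K ≤ L³ ∫ g²`** (block Cauchy–Schwarz summed over the disjoint blocks,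
`8^K ℓ_K³ = L³`): the within-block participation `r̄_K = ℓ_K³ ∫g² / S_K` is `≥ 1` off junk.
[folklore] -/
theorem pow_mul_levelSq_le {g : Space → ℝ≥0∞} (hg : Measurable g) {L : ℝ} (hL : 0 ≤ L) (K : ℕ) :
    8 ^ K * levelSq g L K ≤ ENNReal.ofReal (L ^ 3) * ∫⁻ x, g x ^ 2 := by
  have h8 : (8 : ℝ≥0∞) ^ K * ENNReal.ofReal ((L / 2 ^ K) ^ 3) = ENNReal.ofReal (L ^ 3) := by
    rw [show (8 : ℝ≥0∞) ^ K = ENNReal.ofReal ((8 : ℝ) ^ K) by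
      rw [ENNReal.ofReal_pow (by norm_num)]; norm_num, ← ENNReal.ofReal_mul (by positivity)]
    congr 1
    rw [div_pow, ← pow_mul, show (2 : ℝ) ^ (K * 3) = 8 ^ K by
      rw [mul_comm, pow_mul]; norm_num]
    field_simp
  unfold levelSq
  calc 8 ^ K * ∑ i : Fin 3 → Fin (2 ^ K), blockMass g L K i ^ 2
      ≤ 8 ^ K * ∑ i : Fin 3 → Fin (2 ^ K),
          ENNReal.ofReal ((L / 2 ^ K) ^ 3) * ∫⁻ x in dyadicCube L K i, g x ^ 2 := by
        gcongr with i
        exact blockMass_sq_le hg hL K i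
    _ = ENNReal.ofReal (L ^ 3) * ∑ i : Fin 3 → Fin (2 ^ K), ∫⁻ x in dyadicCube L K i, g x ^ 2 := by
        rw [← Finset.mul_sum, ← mul_assoc, h8]
    _ ≤ ENNReal.ofReal (L ^ 3) * ∫⁻ x, g x ^ 2 :=
        mul_le_mul' le_rfl (sum_setLIntegral_dyadicCube_le L K _)

/-- **`S_0 = (∫ g)²`** for `g` vanishing off `Λ_L` (one block at level `0`, covering the box).
[folklore] -/
theorem levelSq_zero_eq {g : Space → ℝ≥0∞} {L : ℝ} (hL : 0 < L)
    (h0 : ∀ x, x ∉ box L → g x = 0) : levelSq g L 0 = (∫⁻ x, g x) ^ 2 := by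
  refine le_antisymm (levelSq_zero_le g L) ?_
  obtain ⟨i₀, hi₀⟩ := Finset.card_eq_one.1
    (show (Finset.univ : Finset (Fin 3 → Fin (2 ^ 0))).card = 1 by simp)
  have h1 := lintegral_le_sum_blockMass hL h0 0
  unfold levelSq
  rw [hi₀, Finset.sum_singleton] at h1 ⊢
  exact pow_le_pow_left' h1 2

/-- **The across-block participation is dominated by the full participation ratio**: for `g ≥ 0`
measurable, vanishing off `Λ_L` (`L > 0`), with `0 < ∫ g < ∞`, and EVERY depth `K`,
`∏_{j<K} (1 + X_j(g)) = 8^K S_K(g)/S_0(g) ≤ L³ ∫ g² / (∫ g)²` (`prod_ratio_eq`,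
`pow_mul_levelSq_le`, `levelSq_zero_eq`). [folklore] -/
theorem ofReal_coarse_le_ratio {g : Space → ℝ≥0∞} (hg : Measurable g) {L : ℝ} (hL : 0 < L)
    (h0 : ∀ x, x ∉ box L → g x = 0) (hs0 : ∫⁻ x, g x ≠ 0) (hst : ∫⁻ x, g x ≠ ⊤) (K : ℕ) :
    ENNReal.ofReal (∏ j ∈ Finset.range K, (1 + siblingExcess g L j)) ≤
      ENNReal.ofReal (L ^ 3) * (∫⁻ x, g x ^ 2) / (∫⁻ x, g x) ^ 2 := by
  have hSne0 : ∀ j, levelSq g L j ≠ 0 := levelSq_ne_zero hL h0 hs0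
  have hSnetop : ∀ j, levelSq g L j ≠ ⊤ := levelSq_ne_top hst
  have hSr : ∀ j, (levelSq g L j).toReal ≠ 0 := fun j =>
    ENNReal.toReal_ne_zero.2 ⟨hSne0 j, hSnetop j⟩
  have hprod : ∏ j ∈ Finset.range K, (1 + siblingExcess g L j) =
      8 ^ K * (levelSq g L K).toReal / (levelSq g L 0).toReal := by
    rw [← prod_ratio_eq hSr K]
    refine Finset.prod_congr rfl fun j _ => ?_
    unfold siblingExcess
    ring
  have hS0pos : 0 < (levelSq g L 0).toReal := ENNReal.toReal_pos (hSne0 0) (hSnetop 0)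
  rw [hprod, ENNReal.ofReal_div_of_pos hS0pos, ENNReal.ofReal_mul (by positivity),
    ENNReal.ofReal_toReal (hSnetop K), ENNReal.ofReal_toReal (hSnetop 0),
    show ENNReal.ofReal ((8 : ℝ) ^ K) = 8 ^ K by rw [ENNReal.ofReal_pow (by norm_num)]; norm_num,
    levelSq_zero_eq hL h0]
  exact ENNReal.div_le_div_right (pow_mul_levelSq_le hg hL.le K) _

/-! ### The free gas: the IR stub holds with one constant for every `L`, `n`, `T ≥ 0` and every depth -/

/-- **Free gas: the slice-law second moment of the across-block participation is bounded by ONE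
absolute constant**, for `v ≡ 0`, every `L > 0`, every `n`, every `T ≥ 0` and EVERY depth `K`:
`∫ m_T(Y) (∏_{j<K}(1 + X_j(|Ψ_T(·,Y)|)))² dY ≤ C`, `Ψ_T = fkWitness 0 L T 1`. The slice is
`|Ψ_T(·,Y)| = c Z_n(Y) · θ_T` (`fkPartition_vecCons_free`; `θ_T = Z^{(1)}_T` the one-line
Dirichlet survival profile), the sibling excesses are scale-free (`siblingExcess_const_mul`), so
the second factor is the deterministic `(∏_{j<K}(1 + X_j(θ_T)))² ≤ (L³∫θ_T²/(∫θ_T)²)² ≤ C₀²`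
(`ofReal_coarse_le_ratio`, `free_ratio_le`), and `∫ m_T = 1` (or `0` if the normalisation
degenerates). [folklore] -/
theorem stub_coarseSecondMomentFreeGas : ∃ C : ℝ, 0 < C ∧ ∀ L : ℝ, 0 < L → ∀ (n : ℕ) (T : ℝ), 0 ≤ T →
    ∀ K : ℕ,
      ∫⁻ Y : Config n,
          (∫⁻ x, slice (fkWitness (N := n + 1) (fun _ => 0) L T (fun _ => (1 : ℝ≥0∞))) Y x ^ 2) *
            ENNReal.ofReal (∏ j ∈ Finset.range K,
              (1 + siblingExcess
                (slice (fkWitness (N := n + 1) (fun _ => 0) L T (fun _ => (1 : ℝ≥0∞))) Y) L j)) ^ 2 ≤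
        ENNReal.ofReal C := by
  obtain ⟨C₀, hC₀t, hC₀⟩ := free_ratio_le
  refine ⟨C₀.toReal ^ 2 + 1, by positivity, fun L hL n T hT K => ?_⟩
  have hvm : Measurable (fun _ : ℝ => (0 : ℝ≥0∞)) := measurable_const
  set Ψ : Config (n + 1) → ℝ := fkWitness (N := n + 1) (fun _ => 0) L T (fun _ => (1 : ℝ≥0∞))
    with hΨdef
  set 𝒩 : ℝ≥0∞ := fkNormSq (N := n + 1) (fun _ => 0) L T (fun _ => (1 : ℝ≥0∞)) with h𝒩def
  have hΨm : Measurable Ψ := measurable_fkWitness hvm L T measurable_const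
  -- the one-line profile and the bath partition function
  set θ : Space → ℝ≥0∞ := fun x => fkPartition (N := 1) (fun _ => 0) L T (fun _ => x) with hθdef
  set Zn : Config n → ℝ≥0∞ := fun Y => fkPartition (fun _ => 0) L T Y with hZndef
  have hθm : Measurable θ := measurable_fkPartition_one hvm L T
  have hθ1 : ∀ x, θ x ≤ 1 := fun x => fkPartition_le_one _ L T _
  have hθ0 : ∀ x, x ∉ box L → θ x = 0 := fun x hx => by
    have : (fun _ : Fin 1 => x) ∉ boxN 1 L := fun h => hx (h 0)
    simp [hθdef, fkPartition, fkSemigroup_of_notMem (fun _ => (0 : ℝ≥0∞)) hT _ this]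
  have hθtop : ∫⁻ x, θ x ≠ ⊤ := by
    refine ne_top_of_le_ne_top (ENNReal.mul_ne_top ENNReal.one_ne_top (volume_box_ne_top L)) ?_
    calc ∫⁻ x, θ x ≤ ∫⁻ x, (box L).indicator 1 x := lintegral_mono fun x => by
            by_cases hxb : x ∈ box L
            · rw [Set.indicator_of_mem hxb]; exact hθ1 x
            · rw [Set.indicator_of_notMem hxb, hθ0 x hxb]
      _ = 1 * volume (box L) := by rw [lintegral_indicator_one (measurableSet_box L), one_mul]
  -- the slice is `Y`-independent up to the scalar `d Y = c · Z_n(Y)`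
  set c : ℝ := (Real.sqrt 𝒩.toReal)⁻¹ with hcdef
  set d : Config n → ℝ≥0∞ := fun Y => ENNReal.ofReal c * Zn Y with hddef
  have hdt : ∀ Y, d Y ≠ ⊤ := fun Y =>
    ENNReal.mul_ne_top ENNReal.ofReal_ne_top (fkPartition_ne_top _ L T Y)
  have hslice : ∀ Y, slice Ψ Y = fun x => d Y * θ x := by
    intro Y
    funext x
    show ((‖Ψ (Matrix.vecCons x Y)‖₊ : ℝ≥0∞)) = d Y * θ x
    rw [coe_nnnorm_fkWitness, fkWitness_one_eq, fkPartition_vecCons_free,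
      ENNReal.ofReal_mul (inv_nonneg.2 (Real.sqrt_nonneg _)),
      ENNReal.ofReal_toReal (ENNReal.mul_ne_top (fkPartition_ne_top _ L T _)
        (fkPartition_ne_top _ L T Y))]
    simp only [hddef, hθdef, hZndef, hcdef, h𝒩def]
    ring
  -- the deterministic second factor
  set P : ℝ := ∏ j ∈ Finset.range K, (1 + siblingExcess θ L j) with hPdef
  set m : Config n → ℝ≥0∞ := fun Y => ∫⁻ x, slice Ψ Y x ^ 2 with hmdef
  -- total mass of the slice law is at most one
  have hm1 : ∫⁻ Y, m Y ≤ 1 := by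
    by_cases hdeg : 𝒩 = 0 ∨ 𝒩 = ⊤
    · have hΨ0 : ∀ X, Ψ X = 0 := fkWitness_eq_zero_of_normSq hdeg
      have hsl : ∀ Y x, slice Ψ Y x = 0 := fun Y x => by
        simp [LandscapeBound.SiblingTelescopingChaining.slice, hΨ0]
      simp [hmdef, hsl]
    simp only [not_or] at hdeg
    exact (lintegral_lintegral_slice_sq hvm L T hdeg.1 hdeg.2).le
  -- the case of a null profile: every slice mass vanishes
  by_cases hs0 : ∫⁻ x, θ x = 0
  · have hae : θ =ᵐ[volume] 0 := (lintegral_eq_zero_iff hθm).1 hs0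
    have hm0 : ∀ Y, m Y = 0 := fun Y => by
      simp only [hmdef, hslice Y]
      refine (lintegral_eq_zero_iff ((measurable_const.mul hθm).pow_const 2)).2 ?_
      filter_upwards [hae] with x hx
      simp [hx]
    have : ∀ Y, m Y * ENNReal.ofReal (∏ j ∈ Finset.range K,
        (1 + siblingExcess (slice Ψ Y) L j)) ^ 2 = 0 := fun Y => by rw [hm0 Y, zero_mul]
    simp only [hmdef] at this
    simp [this]
  -- the generic case: the second factor is the deterministic `P² ≤ C₀²`
  have hP : ENNReal.ofReal P ≤ C₀ :=
    (ofReal_coarse_le_ratio hθm hL hθ0 hs0 hθtop K).trans (hC₀ _ hvm L hL T hT)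
  have hpt : ∀ Y, m Y * ENNReal.ofReal (∏ j ∈ Finset.range K,
      (1 + siblingExcess (slice Ψ Y) L j)) ^ 2 ≤ m Y * C₀ ^ 2 := by
    intro Y
    rcases eq_or_ne (d Y) 0 with hd0 | hd0
    · have hm0 : m Y = 0 := by simp [hmdef, hslice Y, hd0]
      rw [hm0, zero_mul, zero_mul]
    have hX : ∀ j, siblingExcess (slice Ψ Y) L j = siblingExcess θ L j := fun j => by
      rw [hslice Y]; exact siblingExcess_const_mul hd0 (hdt Y) θ L j
    simp_rw [hX]
    exact mul_le_mul' le_rfl (pow_le_pow_left' hP 2)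
  calc ∫⁻ Y, m Y * ENNReal.ofReal (∏ j ∈ Finset.range K, (1 + siblingExcess (slice Ψ Y) L j)) ^ 2
      ≤ ∫⁻ Y, m Y * C₀ ^ 2 := lintegral_mono hpt
    _ = (∫⁻ Y, m Y) * C₀ ^ 2 := lintegral_mul_const' _ _ (ENNReal.pow_ne_top hC₀t)
    _ ≤ 1 * C₀ ^ 2 := mul_le_mul' hm1 le_rfl
    _ = ENNReal.ofReal (C₀.toReal ^ 2) := by
        rw [one_mul, ENNReal.ofReal_pow ENNReal.toReal_nonneg, ENNReal.ofReal_toReal hC₀t]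
    _ ≤ ENNReal.ofReal (C₀.toReal ^ 2 + 1) := ENNReal.ofReal_le_ofReal (by linarith)

/-- **The free-gas instance of the IR stub `CoarseSecondMomentBeyond`** (`v := fun _ => 0`, every
other quantifier verbatim; `ρ₀ = 1` and the window `κ/ρ ≤ T` are idle, the constant is the absolute
one of `stub_coarseSecondMomentFreeGas`). [folklore] -/
theorem coarseSecondMomentBeyond_free : ∀ κ : ℝ, 0 < κ → ∃ ρ₀ : ℝ, 0 < ρ₀ ∧
    ∀ ρ : ℝ, 0 < ρ → ρ < ρ₀ → ∃ C : ℝ, 0 < C ∧ ∀ᶠ n : ℕ in atTop, ∀ T : ℝ, κ / ρ ≤ T →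
      ∫⁻ Y : Config n,
          (∫⁻ x, slice (fkWitness (N := n + 1) (fun _ => 0) (sideLength ρ (n + 1)) T
            (fun _ => (1 : ℝ≥0∞))) Y x ^ 2) *
            ENNReal.ofReal (∏ j ∈ Finset.range (kineticDepth κ ρ (sideLength ρ (n + 1))),
              (1 + siblingExcess
                (slice (fkWitness (N := n + 1) (fun _ => 0) (sideLength ρ (n + 1)) T
                  (fun _ => (1 : ℝ≥0∞))) Y)
                (sideLength ρ (n + 1)) j)) ^ 2 ≤
        ENNReal.ofReal C := by
  intro κ hκ
  obtain ⟨C, hC, H⟩ := stub_coarseSecondMomentFreeGas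
  refine ⟨1, one_pos, fun ρ hρ _ => ⟨C, hC, Filter.Eventually.of_forall fun n T hT => ?_⟩⟩
  have hL : 0 < sideLength ρ (n + 1) :=
    Real.rpow_pos_of_pos (div_pos (Nat.cast_pos.mpr n.succ_pos) hρ) _
  exact H _ hL n T ((div_pos hκ hρ).le.trans hT) _

/-- `IsRepulsiveFiniteRange (fun _ => 0)`: the free gas is admissible. [folklore] -/
theorem isRepulsiveFiniteRange_zero : IsRepulsiveFiniteRange (fun _ : ℝ => (0 : ℝ≥0∞)) :=
  ⟨measurable_const, 0, fun _ _ => rfl⟩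

end Summit.AtomisticToContinuum.BoseEinsteinCondensation.Cruxes.TwoReplicaTransienceBound.TaggedShiftLogHarnack

end
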